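import Summits.CriticalPhenomena.CardyFormulaZ2.Theorems.CardyBondTriangularBondTriangularCardyCrudeRun

/-!
# Route CardyBondTriangular · crux `BondTriangularCardy` (stmt-CriticalPhenomena-4664), line `birth`,
# stub `stub_yellowCrossingOfCrude`, I: the yellow hexagon chain of an open crude crossing

Helper of the stub `stub_yellowCrossingOfCrude` (`Sig.stub_yellowCrossingOfCrude`, the
deterministic core of the upper half of Bollobás–Riordan's sandwich (19) for critical bond
percolation on `𝕋` in the Chayes–Lei hexagon packaging), first file.

An open crude crossing of `Ω` at mesh `δ/√3` for the route's embedding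
`z x = √3 (triEmbed x - (1+ζ)/3)` is an open bond path `v₀ … v_n` of `𝕋` whose embedded sites
`δ triEmbed v_k - δ(1+ζ)/3` lie in `Ω`, from within `2δ/√3` of `A₀` to within `2δ/√3` of `A₂`.
Each open bond lies in a unique up-triangle, i.e. in a unique Chayes–Lei hexagon, which is then
not pure blue; consecutive bonds share a site which is ACTIVE in both hexagons, so the two hexagons
coincide or share a yellow (half-)edge (`clYellowGraph_clOfBond_adj_iff`). The embedded sites of
the up-triangle of `x` are at distance exactly `δ/√3` from the hexagon centre `δ triEmbed x`
(`dist_bondVertex_center_eq`). Hence (`yellowChain_of_crude`): the crude crossing yields a walk in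
the yellow graph of `clOfBond ω`, all of whose hexagons are non-blue with centres within `2δ` of
`Ω`, from a hexagon within `√3 δ < 2δ` of `A₀` to a hexagon within `2δ` of `A₂` (the degenerate
one-site crossing is excluded as soon as `A₀`, `A₂` are `4δ` apart).

References: B. Bollobás, O. Riordan, *Percolation*, CUP 2006, Ch. 7, Claims 19–20 p. 192;
L. Chayes, H. K. Lei, Rev. Math. Phys. 19 (2007) §2.1.
-/

noncomputable section

namespace Summit.CriticalPhenomena.CardyFormulaZ2.Theorems.BondTriangularCardyLine

open Set Filter Topology Metric
open Literature.Probability.Percolation Literature.Probability.RandomPlanarGeometry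
open Literature.Probability.RandomPlanarGeometry.MarkedDomain
open Literature.Probability.LatticeModels

/-! ### The sites of an up-triangle are at distance `δ/√3` from the hexagon centre -/

/-- The three differences `vertex - (1+ζ)/3 - cell` of an up-triangle have `normSq = 1/3`. -/
theorem normSq_bondVertex_sub_center {x y : Site 2} (hy : y ∈ hexFaceVertices (x, 0)) :
    Complex.normSq (triEmbed y - (1 + triZeta) / 3 - triEmbed x) = 1 / 3 := by
  have h3 : Real.sqrt 3 * Real.sqrt 3 = 3 := Real.mul_self_sqrt (by norm_num)
  rw [mem_hexFaceVertices_zero] at hy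
  rcases hy with h | h | h <;> rw [h]
  · have e : triEmbed x - (1 + triZeta) / 3 - triEmbed x = -((1 + triZeta) / 3) := by ring
    rw [e, Complex.normSq_neg, Complex.normSq_apply]
    simp only [Complex.div_re, Complex.add_re, Complex.one_re, triZeta_re, Complex.add_im,
      Complex.one_im, triZeta_im, Complex.div_im, Complex.normSq_ofNat, Complex.re_ofNat,
      Complex.im_ofNat]
    nlinarith [h3]
  · have e : triEmbed (x + Pi.single 0 1) - (1 + triZeta) / 3 - triEmbed x = 1 - (1 + triZeta) / 3 := by
      rw [triEmbed_add, triEmbed_single_zero]; ring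
    rw [e, Complex.normSq_apply]
    simp only [Complex.sub_re, Complex.one_re, Complex.div_re, Complex.add_re, triZeta_re,
      Complex.add_im, Complex.one_im, triZeta_im, Complex.sub_im, Complex.div_im,
      Complex.normSq_ofNat, Complex.re_ofNat, Complex.im_ofNat]
    nlinarith [h3]
  · have e : triEmbed (x + Pi.single 1 1) - (1 + triZeta) / 3 - triEmbed x = triZeta - (1 + triZeta) / 3 := by
      rw [triEmbed_add, triEmbed_single_one]; ring
    rw [e, Complex.normSq_apply]
    simp only [Complex.sub_re, triZeta_re, Complex.div_re, Complex.add_re, Complex.one_re,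
      Complex.add_im, Complex.one_im, triZeta_im, Complex.sub_im, Complex.div_im,
      Complex.normSq_ofNat, Complex.re_ofNat, Complex.im_ofNat]
    nlinarith [h3]

/-- **The bond-lattice sites of the up-triangle of `x` are at distance exactly `δ/√3` from the
hexagon centre `δ triEmbed x`** (at mesh `δ/√3` the route's embedding places the site `y` at
`δ (triEmbed y - (1+ζ)/3)`). -/
theorem dist_bondVertex_center_eq {x y : Site 2} (hy : y ∈ hexFaceVertices (x, 0)) {δ : ℝ} (hδ : 0 ≤ δ) :
    dist ((δ : ℂ) * (triEmbed y - (1 + triZeta) / 3)) (triMeshPoint δ x) = δ / Real.sqrt 3 := by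
  rw [dist_eq_norm, triMeshPoint, ← mul_sub, norm_mul, Complex.norm_real, Real.norm_of_nonneg hδ,
    Complex.norm_def, normSq_bondVertex_sub_center hy, one_div, Real.sqrt_inv, div_eq_mul_inv]

/-- An active site of the packaged triangle of `x` is at distance `δ/√3` from the hexagon centre. -/
theorem dist_of_isActiveSite {ω : BondConfig (Site 2)} {x w : Site 2} (h : IsActiveSite ω x w) {δ : ℝ} (hδ : 0 ≤ δ) :
    dist ((δ : ℂ) * (triEmbed w - (1 + triZeta) / 3)) (triMeshPoint δ x) = δ / Real.sqrt 3 := by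
  obtain ⟨j, -, hwj⟩ := h
  obtain ⟨k, -, rfl⟩ := exists_eq_faceVertex_of_mem_triBond hwj
  exact dist_bondVertex_center_eq (faceVertex_mem (x, 0) k) hδ

/-- `3 (δ/√3) = √3 δ < 2δ` for `δ > 0`. -/
theorem three_mul_div_sqrt_three_lt {δ : ℝ} (hδ : 0 < δ) : 3 * (δ / Real.sqrt 3) < 2 * δ := by
  have h3 : 0 < Real.sqrt 3 := Real.sqrt_pos.2 (by norm_num)
  have h33 : Real.sqrt 3 * Real.sqrt 3 = 3 := Real.mul_self_sqrt (by norm_num)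
  rw [mul_div_assoc', div_lt_iff₀ h3]
  nlinarith [h33, h3]

/-- A hexagon with an active site is not pure blue. -/
theorem clOfBond_ne_B_of_isActiveSite {ω : BondConfig (Site 2)} {x w : Site 2} (h : IsActiveSite ω x w) :
    clOfBond ω x ≠ CLHexState.B := by
  obtain ⟨j, hj, -⟩ := h
  rw [Ne, clOfBond_eq_B_iff]
  exact fun hB => hB j hj

/-! ### The hexagon chain of an open bond path -/

/-- **Two packaged triangles with a common active site are joined by a yellow walk of length
`≤ 1`** (they are equal, or adjacent sharing a yellow half-edge at that site; the adjacency is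
that of `clYellowGraph_reachable_of_isActiveSite`, here with the walk kept explicit). -/
theorem exists_yellowWalk_of_common_activeSite {ω : BondConfig (Site 2)} {x x' u : Site 2}
    (hx : IsActiveSite ω x u) (hx' : IsActiveSite ω x' u) :
    ∃ Y : (clYellowGraph (clOfBond ω)).Walk x x', ∀ z ∈ Y.support, z = x ∨ z = x' := by
  by_cases hxx' : x = x'
  · subst hxx'
    exact ⟨SimpleGraph.Walk.nil, fun z hz => Or.inl (by simpa using hz)⟩
  -- adapted from `clYellowGraph_reachable_of_isActiveSite` (ChayesLeiHexProofs)
  have hadj : (clYellowGraph (clOfBond ω)).Adj x x' := by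
    refine (clYellowGraph_clOfBond_adj_iff ω x x').2 ⟨?_, u, hx, hx'⟩
    obtain ⟨j, -, huj⟩ := hx
    obtain ⟨j', -, huj'⟩ := hx'
    obtain ⟨k, -, rfl⟩ := exists_eq_faceVertex_of_mem_triBond huj
    obtain ⟨k', -, hk'⟩ := exists_eq_faceVertex_of_mem_triBond huj'
    have hD : downCorner x k = downCorner x' k' := (downCorner_eq_downCorner_iff x x' k' k).2 hk'
    exact adj_of_mem_hexFaceVertices (mem_hexFaceVertices_downCorner x k) (hD ▸ mem_hexFaceVertices_downCorner x' k') hxx'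
  exact ⟨SimpleGraph.Walk.cons hadj SimpleGraph.Walk.nil, fun z hz => by simpa using hz⟩

/-- **The hexagon chain of an open bond path.** Along a `𝕋`-walk `W` with open bonds, starting
from any hexagon `x` in which the first site is active, there is a walk in the yellow graph of
`clOfBond ω` from `x` to a hexagon in which the last site is active, every hexagon of which has an
active site on `W`. -/
theorem exists_yellowWalk_of_openWalk {ω : BondConfig (Site 2)} :
    ∀ {u v : Site 2} (W : triGraph.Walk u v), (∀ e ∈ W.edges, e ∈ ω) →
      ∀ {x : Site 2}, IsActiveSite ω x u →
        ∃ (y : Site 2) (Y : (clYellowGraph (clOfBond ω)).Walk x y), IsActiveSite ω y v ∧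
          ∀ z ∈ Y.support, ∃ w ∈ W.support, IsActiveSite ω z w := by
  intro u v W
  induction W with
  | nil =>
    intro _ x hx
    refine ⟨x, SimpleGraph.Walk.nil, hx, fun z hz => ⟨_, SimpleGraph.Walk.start_mem_support _, ?_⟩⟩
    rw [SimpleGraph.Walk.support_nil, List.mem_singleton] at hz
    rw [hz]; exact hx
  | @cons a b c hab W' ih =>
    intro hE x hx
    have habω : s(a, b) ∈ ω := hE _ (by rw [SimpleGraph.Walk.edges_cons]; exact List.mem_cons_self)
    obtain ⟨x₁, j₁, h₁⟩ := exists_triBond_eq_of_mem_edgeSet ((SimpleGraph.mem_edgeSet triGraph).2 hab)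
    have hxa : IsActiveSite ω x₁ a := ⟨j₁, h₁ ▸ habω, h₁ ▸ Sym2.mem_mk_left a b⟩
    have hxb : IsActiveSite ω x₁ b := ⟨j₁, h₁ ▸ habω, h₁ ▸ Sym2.mem_mk_right a b⟩
    obtain ⟨y, Y', hy, hY'⟩ := ih (fun e he => hE e (by
      rw [SimpleGraph.Walk.edges_cons]; exact List.mem_cons_of_mem _ he)) hxb
    obtain ⟨Y₀, hY₀⟩ := exists_yellowWalk_of_common_activeSite hx hxa
    refine ⟨y, Y₀.append Y', hy, fun z hz => ?_⟩
    rw [SimpleGraph.Walk.mem_support_append_iff] at hz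
    rcases hz with hz | hz
    · rcases hY₀ z hz with rfl | rfl
      · exact ⟨a, SimpleGraph.Walk.start_mem_support _, hx⟩
      · exact ⟨a, SimpleGraph.Walk.start_mem_support _, hxa⟩
    · obtain ⟨w, hw, hzw⟩ := hY' z hz
      exact ⟨w, by rw [SimpleGraph.Walk.support_cons]; exact List.mem_cons_of_mem _ hw, hzw⟩

/-! ### The yellow chain of a crude crossing -/

/-- **The yellow hexagon chain of an open crude crossing.** Let `0 < δ`, `ω ⊆ E(𝕋)`, and assume
`A₀`, `A₂` are at least `4δ` apart. If `ω` has an open crude crossing of `Ω` at mesh `δ/√3` for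
the route's embedding (an open bond path with embedded sites in `Ω` from within `2δ/√3` of `A₀`
to within `2δ/√3` of `A₂`), then there is a walk in the yellow graph of the packaged configuration
`clOfBond ω` from a hexagon whose centre is within `< 2δ` of `A₀` to a hexagon within `< 2δ` of
`A₂`, all of whose hexagons are not pure blue and have centres within `2δ` of `Ω`. -/
theorem yellowChain_of_crude (R : ConformalRectangle) (δ : ℝ) (ω : BondConfig (Site 2)) (hδ : 0 < δ)
    (hωE : ω ⊆ triGraph.edgeSet) (hA : ∀ a ∈ R.arc 0, ∀ b ∈ R.arc 2, 4 * δ ≤ dist a b)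
    (hcrude : ω ∈ embDomainCrossing (fun x : Site 2 ↦ (Real.sqrt 3 : ℂ) * (triEmbed x - (1 + triZeta) / 3))
      R.carrier (δ / Real.sqrt 3) (R.arc 0) (R.arc 2)) :
    ∃ (x₀ y : Site 2) (Y : (clYellowGraph (clOfBond ω)).Walk x₀ y),
      infDist (triMeshPoint δ x₀) (R.arc 0) < 2 * δ ∧ infDist (triMeshPoint δ y) (R.arc 2) < 2 * δ ∧
      ∀ z ∈ Y.support, clOfBond ω z ≠ CLHexState.B ∧ infDist (triMeshPoint δ z) R.carrier ≤ 2 * δ := by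
  have hA0ne : (R.arc 0).Nonempty := ⟨_, R.pt_mem_arc_self 0⟩
  have hA2ne : (R.arc 2).Nonempty := ⟨_, R.pt_mem_arc_self 2⟩
  set q : Site 2 → ℂ := fun y => (δ : ℂ) * (triEmbed y - (1 + triZeta) / 3) with hq
  have hscale : ∀ y : Site 2, ((δ / Real.sqrt 3 : ℝ) : ℂ) * ((Real.sqrt 3 : ℂ) * (triEmbed y - (1 + triZeta) / 3)) = q y :=
    fun y => embScale_mul_zT δ y
  have h32 : 3 * (δ / Real.sqrt 3) < 2 * δ := three_mul_div_sqrt_three_lt hδ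
  have hs0 : 0 ≤ δ / Real.sqrt 3 := div_nonneg hδ.le (Real.sqrt_nonneg 3)
  rw [mem_embDomainCrossing_iff] at hcrude
  obtain ⟨u, hu, v, hv, hconn⟩ := hcrude
  rw [hscale] at hu hv
  have hS : {y : Site 2 | ((δ / Real.sqrt 3 : ℝ) : ℂ) * ((Real.sqrt 3 : ℂ) * (triEmbed y - (1 + triZeta) / 3)) ∈ R.carrier} =
      {y | q y ∈ R.carrier} := by
    ext y; simp only [mem_setOf_eq, hscale]
  rw [hS] at hconn
  obtain ⟨W, hWΩ, hWω⟩ := exists_walk_of_mem_openConnIn hωE hconn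
  cases W with
  | nil =>
    -- a one-site crossing: `A₀` and `A₂` would be within `4δ/√3 < 4δ`
    exfalso
    obtain ⟨a, ha, hda⟩ := (infDist_lt_iff hA0ne).1 (lt_of_le_of_lt hu (by linarith : 2 * (δ / Real.sqrt 3) < 2 * δ))
    obtain ⟨b, hb, hdb⟩ := (infDist_lt_iff hA2ne).1 (lt_of_le_of_lt hv (by linarith : 2 * (δ / Real.sqrt 3) < 2 * δ))
    have h1 := hA a ha b hb
    have h2 := dist_triangle_left a b (q u)
    linarith
  | cons hab W' =>
    have habω : s(u, _) ∈ ω := hWω _ (by rw [SimpleGraph.Walk.edges_cons]; exact List.mem_cons_self)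
    obtain ⟨x₀, j₀, h₀⟩ := exists_triBond_eq_of_mem_edgeSet ((SimpleGraph.mem_edgeSet triGraph).2 hab)
    have hx₀u : IsActiveSite ω x₀ u := ⟨j₀, h₀ ▸ habω, h₀ ▸ Sym2.mem_mk_left _ _⟩
    obtain ⟨y, Y, hyv, hY⟩ := exists_yellowWalk_of_openWalk (SimpleGraph.Walk.cons hab W') hWω hx₀u
    refine ⟨x₀, y, Y, ?_, ?_, fun z hz => ?_⟩
    · have h1 := infDist_le_infDist_add_dist (s := R.arc 0) (x := triMeshPoint δ x₀) (y := q u)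
      have h2 : dist (triMeshPoint δ x₀) (q u) = δ / Real.sqrt 3 := by
        rw [dist_comm]; exact dist_of_isActiveSite hx₀u hδ.le
      linarith
    · have h1 := infDist_le_infDist_add_dist (s := R.arc 2) (x := triMeshPoint δ y) (y := q v)
      have h2 : dist (triMeshPoint δ y) (q v) = δ / Real.sqrt 3 := by
        rw [dist_comm]; exact dist_of_isActiveSite hyv hδ.le
      linarith
    · obtain ⟨w, hw, hzw⟩ := hY z hz
      refine ⟨clOfBond_ne_B_of_isActiveSite hzw, ?_⟩
      have h1 : infDist (triMeshPoint δ z) R.carrier ≤ dist (triMeshPoint δ z) (q w) := infDist_le_dist_of_mem (hWΩ w hw)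
      have h2 : dist (triMeshPoint δ z) (q w) = δ / Real.sqrt 3 := by
        rw [dist_comm]; exact dist_of_isActiveSite hzw hδ.le
      linarith

/-! ### Registered anchor -/

/-- **Registered anchor of this file** (`yellowOfCrude_chain`, helper of the stub
`stub_yellowCrossingOfCrude`): the yellow hexagon chain of an open crude crossing, arrow form of
`yellowChain_of_crude`. -/
theorem yellowOfCrude_chain : ∀ (R : Literature.Probability.RandomPlanarGeometry.ConformalRectangle) (δ : ℝ) (ω : Literature.Probability.Percolation.BondConfig (Literature.Probability.LatticeModels.Site 2)), 0 < δ → ω ⊆ Literature.Probability.LatticeModels.triGraph.edgeSet → (∀ a ∈ R.arc 0, ∀ b ∈ R.arc 2, 4 * δ ≤ dist a b) → ω ∈ Literature.Probability.Percolation.embDomainCrossing (fun x : Literature.Probability.LatticeModels.Site 2 ↦ (Real.sqrt 3 : ℂ) * (Literature.Probability.LatticeModels.triEmbed x - (1 + Literature.Probability.LatticeModels.triZeta) / 3)) R.carrier (δ / Real.sqrt 3) (R.arc 0) (R.arc 2) → ∃ (x₀ y : Literature.Probability.LatticeModels.Site 2) (Y : (Literature.Probability.Percolation.clYellowGraph (Literature.Probability.Percolation.clOfBond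 ω)).Walk x₀ y), Metric.infDist (Literature.Probability.LatticeModels.triMeshPoint δ x₀) (R.arc 0) < 2 * δ ∧ Metric.infDist (Literature.Probability.LatticeModels.triMeshPoint δ y) (R.arc 2) < 2 * δ ∧ ∀ z ∈ Y.support, Literature.Probability.Percolation.clOfBond ω z ≠ Literature.Probability.Percolation.CLHexState.B ∧ Metric.infDist (Literature.Probability.LatticeModels.triMeshPoint δ z) R.carrier ≤ 2 * δ :=
  fun R δ ω hδ hωE hA hcrude => yellowChain_of_crude R δ ω hδ hωE hA hcrude

end Summit.CriticalPhenomena.CardyFormulaZ2.Theorems.BondTriangularCardyLine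

end
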